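import Summits.CriticalPhenomena.Ising3D.TaylorTableOddHeadCert2
import Summits.CriticalPhenomena.Ising3D.TaylorTableHeadsC
import HarnessLib

/-! LANE-DEPTH OPTION (boot-1 g21, 2026-08-25): this file = module 10 `TaylorTableOddHeadCert2Capstone` (frozen e1b33ec2…) followed by `TaylorTableOddHeadCert2CapstoneC` (frozen ec92cef1…), bodies byte-identical minus their import lines, filed under the CapstoneC module name so that `TaylorTableCertB3RegionLegs` imports it unchanged — one hub build instead of two. lottery ticket; floor = tightest certified 3D Ising CFT bounds; no exact-solution claim without a proof -/


/-!
# XXXIg: `OddHeadCert2`, `oddHeads_of_cert2`, `boxExcluded_of_taylorTable_cert2`, and the MIXED pair (`oddHeads_of_certMixed`, `boxExcluded_of_taylorTable_certMixed`)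
(cell `pub-ising3x`, seat boot-1 gen 15/16; the MERGED-2 (first-order) odd-head test chain, landed per LEAN-PLAN-MERGED2 in ten modules)

HONEST FRAMING: lottery ticket; floor = tightest certified 3D Ising CFT bounds; no exact-solution
claim without a proof. Island framing: certified exclusion region at stated derivative order and
assumptions; not a determination of the 3D Ising critical exponents beyond that.

[folklore]
-/

namespace Summit.CriticalPhenomena.Ising3D

open Finset Set
open Literature.Analysis.ValidatedNumerics Literature.Analysis.ValidatedNumerics.PolyMP
open Literature.Analysis.ValidatedNumerics.NumericsMP
open Literature.MathematicalPhysics.QuantumFieldTheory.ConformalBootstrap3D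
open Literature.MathematicalPhysics.QuantumFieldTheory.ConformalBootstrap3D.HRTM
open Literature.MathematicalPhysics.QuantumFieldTheory.ConformalBootstrap3D.PointKernel (mulQ mem_mulQ legendreLamQ)

/-- A MERGED-2 odd head certificate: odd δ-rows, the τ-width fraction, the centre scalars, and per table cell a model cell, a bisection
depth, the merged-2 parts (the scalar facts `Scal2OK` are supplied by `scal2Check_sound` or `scal2Check2_sound` from a `Scal2Cert`). [folklore] -/
structure OddHeadCert2 where
  /-- the δ-expanded odd rows -/
  R : OddHeadRowsΔ
  /-- τ-width numerator (`Wt ≤ Wn/Wd`) -/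
  Wn : ℤ
  /-- τ-width denominator -/
  Wd : ℕ
  /-- centre scalars used by the kernel -/
  sc : HeadParts2.Scal2
  /-- per table cell: model cell, bisection depth, parts -/
  cells : List (EvenCellTM × ℕ × List HeadParts2.HeadPart2)

namespace OddHeadCert2

variable (H : OddHeadCert2)

/-- The empty merged-2 part (default). [folklore] -/
def emptyPart : HeadParts2.HeadPart2 := ⟨0, 0, [], [], [], []⟩
/-- Model cell `i`. [folklore] -/
def cellTM (i : ℕ) : EvenCellTM := (H.cells.getD i (EvenCellTM.empty, 0, [])).1
/-- Bisection depth of cell `i`. [folklore] -/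
def celldP (i : ℕ) : ℕ := (H.cells.getD i (EvenCellTM.empty, 0, [])).2.1
/-- Parts of cell `i`. [folklore] -/
def cellParts (i : ℕ) : List HeadParts2.HeadPart2 := (H.cells.getD i (EvenCellTM.empty, 0, [])).2.2
/-- Number of parts of cell `i`. [folklore] -/
def numParts (i : ℕ) : ℕ := (H.cellParts i).length
/-- Part `k` of cell `i`. [folklore] -/
def part (i k : ℕ) : HeadParts2.HeadPart2 := (H.cellParts i).getD k emptyPart
/-- The three τ-triple tables of a cell (functions; the kernel files prove literal tables equal to them). [folklore] -/
def TS (C : EvenCellTM) : List (List HRTMAB2.TPoly) :=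
  HRTMAB2.rows2 H.R.S C.ctr C.ℓ C.e C.D H.Wn H.Wd (-(H.R.t0 / 2)) (-1 / 2) (H.R.t0 / 2) (1 / 2) C.nF
/-- [folklore] -/
def TP (C : EvenCellTM) : List (List HRTMAB2.TPoly) :=
  HRTMAB2.rows2 H.R.S C.ctr C.ℓ C.e C.D H.Wn H.Wd (H.R.t0 / 2) (1 / 2) (H.R.t0 / 2) (1 / 2) C.nF
/-- [folklore] -/
def TM (C : EvenCellTM) : List (List HRTMAB2.TPoly) :=
  HRTMAB2.rows2 H.R.S C.ctr C.ℓ C.e C.D H.Wn H.Wd (-(H.R.t0 / 2)) (-1 / 2) (-(H.R.t0 / 2)) (-1 / 2) C.nF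
/-- **Part check `(i, k)`** (established from literal-table files via `oddPartOK2_of_group` / table equalities). [folklore] -/
def partOK (i k : ℕ) : Bool :=
  HeadParts2.oddPartOK2 H.R (H.cellTM i) (H.TS (H.cellTM i)) (H.TP (H.cellTM i)) (H.TM (H.cellTM i)) H.sc H.Wn H.Wd (H.part i k)
/-- **Final check of cell `i`**. [folklore] -/
def finalOK (i : ℕ) : Bool := HeadParts2.oddHeadFinalOK2 H.R (H.celldP i) (H.cellTM i) (H.cellParts i)
/-- Width check `0 < Wd ∧ Wt·Wd ≤ Wn`. [folklore] -/
def widthOK : Bool := decide (0 < H.Wd) && decide (H.R.Wt * H.Wd ≤ H.Wn)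

end OddHeadCert2

namespace TaylorTable

variable (T : TaylorTable)

/-- Alignment of the table's odd cells with the merged-2 certificate's model cells. [folklore] -/
def oddMatchOK2 (H : OddHeadCert2) : Bool :=
  decide (H.cells.length = T.oddCells.length) &&
    (List.range T.oddCells.length).all fun i =>
      match T.oddCells[i]? with
      | some C => oddCellMatch C (H.cellTM i)
      | none => false

/-- **`OddHeads` from a MERGED-2 odd head certificate.** [cite: KosPolandSimmonsduffin2014, §3.3 eq. (3.16)] -/
theorem oddHeads_of_cert2 (H : OddHeadCert2) (hS : T.oddCells.all T.checkOddCellS = true)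
    (hm : T.oddMatchOK2 H = true) (hV : H.R.ValidΔ T.c T.L T.ψ T.Lψ T.σlo T.σhi T.εlo T.εhi)
    (hE : HeadParts2.Scal2OK H.R.S H.R.σ0 H.R.ε0 H.R.Wσ H.R.Wε T.κ₀ H.sc) (hW : H.widthOK = true)
    (hparts : ∀ i k : ℕ, i < T.oddCells.length → k < H.numParts i → H.partOK i k = true)
    (hfinal : ∀ i : ℕ, i < T.oddCells.length → H.finalOK i = true) : T.OddHeads := by
  intro C hC p hp Δ hlo hhi hbΔ
  obtain ⟨i, hi, hCi⟩ := List.getElem_of_mem hC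
  simp only [oddMatchOK2, Bool.and_eq_true, decide_eq_true_eq, List.all_eq_true, List.mem_range] at hm
  obtain ⟨_, hall⟩ := hm
  have hmi := hall i hi
  rw [List.getElem?_eq_getElem hi, hCi] at hmi
  obtain ⟨hℓ, hF, hlo', hhi', hℓlo⟩ := oddCellMatch_spec hmi
  rw [List.all_eq_true] at hS
  have hcell := hS C hC
  simp only [checkOddCellS, Bool.and_eq_true, decide_eq_true_eq, List.all_eq_true] at hcell
  obtain ⟨⟨⟨hFnd, hFj⟩, _⟩, _⟩ := hcell
  have hFnd' : (H.cellTM i).F.Nodup := by rw [hF]; exact hFnd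
  have hFj' : ∀ q ∈ (H.cellTM i).F, q.2 ≤ (H.cellTM i).ℓ + q.1 := by rw [hF, hℓ]; exact fun q hq => hFj q hq
  have hparts' : ∀ p' ∈ H.cellParts i, HeadParts2.oddPartOK2 H.R (H.cellTM i) (H.TS (H.cellTM i)) (H.TP (H.cellTM i))
      (H.TM (H.cellTM i)) H.sc H.Wn H.Wd p' = true := by
    intro p' hp'
    obtain ⟨k, hk, hpk⟩ := List.getElem_of_mem hp'
    simpa only [OddHeadCert2.partOK, OddHeadCert2.part, List.getD_eq_getElem _ _ hk, hpk] using hparts i k hi hk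
  obtain ⟨hK, hdK, hC0, hdC0, hCt, hdCt, hU, hU1⟩ := hE
  simp only [OddHeadCert2.widthOK, Bool.and_eq_true, decide_eq_true_eq] at hW
  obtain ⟨hWd, hWn⟩ := hW
  have hWt : ((H.R.Wt : ℚ) : ℝ) ≤ (H.Wn : ℝ) / H.Wd := by
    have hWd' : (0 : ℝ) < (H.Wd : ℝ) := by exact_mod_cast hWd
    rw [le_div_iff₀ hWd']
    exact_mod_cast hWn
  have hlo'' : ((H.cellTM i).lo : ℝ) ≤ Δ := le_trans (by exact_mod_cast hlo') hlo
  have hhi'' : Δ ≤ ((H.cellTM i).hi : ℝ) := le_trans hhi (by exact_mod_cast hhi')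
  have hbΔ' : unitarityBound3D (H.cellTM i).ℓ < Δ := by rw [hℓ]; exact hbΔ
  have h := HeadParts2.oddHead_nonneg_of_parts2 T.c T.ψ hFnd' hFj' hℓlo hV hWd hWt rfl rfl rfl
    hK hdK hC0 hdC0 hCt hdCt hU hU1 hparts' (hfinal i hi) p hp Δ hlo'' hhi'' hbΔ'
  rw [hF, hℓ] at h; exact h

/-- **Capstone with a MERGED-2 odd head certificate** (all odd cells certified by the merged-2 test; even side as in file XXX).
[cite: KosPolandSimmonsduffin2014, §3.3 eq. (3.16)] -/
theorem boxExcluded_of_taylorTable_cert2 (h : T.checkS = true)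
    (HE : EvenHeadCertΔ) (hmE : T.evenMatchOKΔ HE = true) (hVE : HE.R.ValidΔ T.c T.L T.σlo T.σhi T.εlo T.εhi)
    (hpE : ∀ i k : ℕ, i < T.evenCells.length → k < HE.numParts i → HE.partOK i k = true)
    (hfE : ∀ i : ℕ, i < T.evenCells.length → HE.finalOK i = true)
    (HO : OddHeadCert2) (hmO : T.oddMatchOK2 HO = true) (hVO : HO.R.ValidΔ T.c T.L T.ψ T.Lψ T.σlo T.σhi T.εlo T.εhi)
    (hEO : HeadParts2.Scal2OK HO.R.S HO.R.σ0 HO.R.ε0 HO.R.Wσ HO.R.Wε T.κ₀ HO.sc) (hWO : HO.widthOK = true)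
    (hpO : ∀ i k : ℕ, i < T.oddCells.length → k < HO.numParts i → HO.partOK i k = true)
    (hfO : ∀ i : ℕ, i < T.oddCells.length → HO.finalOK i = true)
    (hR : TaylorEvenRegion T.α T.box ((T.E₀ : ℚ) : ℝ)) (hC : T.OddCone) : BoxExcluded T.box := by
  have h' := h; simp only [checkS, Bool.and_eq_true] at h'
  obtain ⟨⟨⟨⟨⟨_, _⟩, hEcells⟩, _⟩, hOcells⟩, _⟩ := h'
  exact T.boxExcluded_of_taylorTable_heads h (T.evenHeads_of_certΔ HE hEcells hmE hVE hpE hfE)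
    (T.oddHeads_of_cert2 HO hOcells hmO hVO hEO hWO hpO hfO) hR hC

/-- **`OddHeads` from a MIXED pair of odd head certificates** (adaptive layouts, LEAN-PLAN E4): every table cell `i` is certified EITHER by the
order-0/Δ-merged certificate `HΔ` (`sel i = false`: its parts + merged final `oddFinalOKM`) OR by the merged-2 certificate `H2` (`sel i = true`);
both certificates list model cells matching ALL table cells (cells not selected for a certificate carry no obligations there).
The three power-enclosure memberships at `HΔ`'s scale are a HYPOTHESIS `hsc` (route-agnostic: `scalars_mem_of_checkIdentity` for the natural identity
check, `scalars_mem_of_checkIdentityC` (TaylorTableHeadsC) for the centred one — boot-1 g17, T6). [cite: KosPolandSimmonsduffin2014, §3.3 eq. (3.16)] -/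
theorem oddHeads_of_certMixed (sel : ℕ → Bool) (HΔ : OddHeadCertΔ) (H2 : OddHeadCert2)
    (hsc : ∀ p ∈ T.box, MI.mem HΔ.R.S ((1 / 2 : ℝ) ^ (p.2 - p.1)) (T.KI HΔ.R.S) ∧
      MI.mem HΔ.R.S ((1 / 2 : ℝ) ^ (-(2 * p.1))) (T.MσI HΔ.R.S) ∧ MI.mem HΔ.R.S ((1 / 2 : ℝ) ^ (-(2 * p.2))) (T.MεI HΔ.R.S))
    (hS : T.oddCells.all T.checkOddCellS = true)
    (hmΔ : T.oddMatchOKΔ HΔ = true) (hVΔ : HΔ.R.ValidΔ T.c T.L T.ψ T.Lψ T.σlo T.σhi T.εlo T.εhi)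
    (hm2 : T.oddMatchOK2 H2 = true) (hV2 : H2.R.ValidΔ T.c T.L T.ψ T.Lψ T.σlo T.σhi T.εlo T.εhi)
    (hE : HeadParts2.Scal2OK H2.R.S H2.R.σ0 H2.R.ε0 H2.R.Wσ H2.R.Wε T.κ₀ H2.sc) (hW : H2.widthOK = true)
    (hpartsΔ : ∀ i k : ℕ, i < T.oddCells.length → sel i = false → k < HΔ.numParts i → HΔ.partOK i k = true)
    (hfinalΔ : ∀ i : ℕ, i < T.oddCells.length → sel i = false → T.oddFinalOKM HΔ i = true)
    (hparts2 : ∀ i k : ℕ, i < T.oddCells.length → sel i = true → k < H2.numParts i → H2.partOK i k = true)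
    (hfinal2 : ∀ i : ℕ, i < T.oddCells.length → sel i = true → H2.finalOK i = true) : T.OddHeads := by
  intro C hC p hp Δ hlo hhi hbΔ
  obtain ⟨i, hi, hCi⟩ := List.getElem_of_mem hC
  rw [List.all_eq_true] at hS
  have hcell := hS C hC
  simp only [checkOddCellS, Bool.and_eq_true, decide_eq_true_eq, List.all_eq_true] at hcell
  obtain ⟨⟨⟨hFnd, hFj⟩, _⟩, _⟩ := hcell
  cases hsel : sel i with
  | true =>
      simp only [oddMatchOK2, Bool.and_eq_true, decide_eq_true_eq, List.all_eq_true, List.mem_range] at hm2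
      obtain ⟨_, hall⟩ := hm2
      have hmi := hall i hi
      rw [List.getElem?_eq_getElem hi, hCi] at hmi
      obtain ⟨hℓ, hF, hlo', hhi', hℓlo⟩ := oddCellMatch_spec hmi
      have hFnd' : (H2.cellTM i).F.Nodup := by rw [hF]; exact hFnd
      have hFj' : ∀ q ∈ (H2.cellTM i).F, q.2 ≤ (H2.cellTM i).ℓ + q.1 := by rw [hF, hℓ]; exact fun q hq => hFj q hq
      have hparts' : ∀ p' ∈ H2.cellParts i, HeadParts2.oddPartOK2 H2.R (H2.cellTM i) (H2.TS (H2.cellTM i)) (H2.TP (H2.cellTM i))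
          (H2.TM (H2.cellTM i)) H2.sc H2.Wn H2.Wd p' = true := by
        intro p' hp'
        obtain ⟨k, hk, hpk⟩ := List.getElem_of_mem hp'
        simpa only [OddHeadCert2.partOK, OddHeadCert2.part, List.getD_eq_getElem _ _ hk, hpk] using hparts2 i k hi hsel hk
      obtain ⟨hK, hdK, hC0, hdC0, hCt, hdCt, hU, hU1⟩ := hE
      simp only [OddHeadCert2.widthOK, Bool.and_eq_true, decide_eq_true_eq] at hW
      obtain ⟨hWd, hWn⟩ := hW
      have hWt : ((H2.R.Wt : ℚ) : ℝ) ≤ (H2.Wn : ℝ) / H2.Wd := by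
        have hWd' : (0 : ℝ) < (H2.Wd : ℝ) := by exact_mod_cast hWd
        rw [le_div_iff₀ hWd']
        exact_mod_cast hWn
      have hlo'' : ((H2.cellTM i).lo : ℝ) ≤ Δ := le_trans (by exact_mod_cast hlo') hlo
      have hhi'' : Δ ≤ ((H2.cellTM i).hi : ℝ) := le_trans hhi (by exact_mod_cast hhi')
      have hbΔ' : unitarityBound3D (H2.cellTM i).ℓ < Δ := by rw [hℓ]; exact hbΔ
      have h := HeadParts2.oddHead_nonneg_of_parts2 T.c T.ψ hFnd' hFj' hℓlo hV2 hWd hWt rfl rfl rfl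
        hK hdK hC0 hdC0 hCt hdCt hU hU1 hparts' (hfinal2 i hi hsel) p hp Δ hlo'' hhi'' hbΔ'
      rw [hF, hℓ] at h; exact h
  | false =>
      simp only [oddMatchOKΔ, Bool.and_eq_true, decide_eq_true_eq, List.all_eq_true, List.mem_range] at hmΔ
      obtain ⟨⟨⟨_, ht₁⟩, ht₂⟩, hall⟩ := hmΔ
      have hmi := hall i hi
      rw [List.getElem?_eq_getElem hi, hCi] at hmi
      obtain ⟨hℓ, hF, hlo', hhi', hℓlo⟩ := oddCellMatch_spec hmi
      have hFnd' : (HΔ.cellTM i).F.Nodup := by rw [hF]; exact hFnd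
      have hFj' : ∀ q ∈ (HΔ.cellTM i).F, q.2 ≤ (HΔ.cellTM i).ℓ + q.1 := by rw [hF, hℓ]; exact fun q hq => hFj q hq
      have hparts' : ∀ p' ∈ HΔ.cellParts i, oddHeadPartOKΔ HΔ.R (HΔ.cellTM i) HΔ.t₁ HΔ.t₂ p' = true := by
        intro p' hp'
        obtain ⟨k, hk, hpk⟩ := List.getElem_of_mem hp'
        simpa only [OddHeadCertΔ.partOK, OddHeadCertΔ.part, List.getD_eq_getElem _ _ hk, hpk] using hpartsΔ i k hi hsel hk
      have hlo'' : ((HΔ.cellTM i).lo : ℝ) ≤ Δ := le_trans (by exact_mod_cast hlo') hlo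
      have hhi'' : Δ ≤ ((HΔ.cellTM i).hi : ℝ) := le_trans hhi (by exact_mod_cast hhi')
      have hbΔ' : unitarityBound3D (HΔ.cellTM i).ℓ < Δ := by rw [hℓ]; exact hbΔ
      have h := oddHead_nonneg_of_partsΔM T.c T.ψ hFnd' hFj' hℓlo hVΔ ht₁ ht₂ (fun q hq => (hsc q hq).1)
        (fun q hq => (hsc q hq).2.1) (fun q hq => (hsc q hq).2.2) hparts' (hfinalΔ i hi hsel) p hp Δ hlo'' hhi'' hbΔ'
      rw [hF, hℓ] at h; exact h

/-- **Capstone with a MIXED odd head certificate pair** (adaptive layouts: order-0/Δ-merged cells + merged-2 cells).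
[cite: KosPolandSimmonsduffin2014, §3.3 eq. (3.16)] -/
theorem boxExcluded_of_taylorTable_certMixed (h : T.checkS = true)
    (HE : EvenHeadCertΔ) (hmE : T.evenMatchOKΔ HE = true) (hVE : HE.R.ValidΔ T.c T.L T.σlo T.σhi T.εlo T.εhi)
    (hpE : ∀ i k : ℕ, i < T.evenCells.length → k < HE.numParts i → HE.partOK i k = true)
    (hfE : ∀ i : ℕ, i < T.evenCells.length → HE.finalOK i = true)
    (sel : ℕ → Bool) (HΔ : OddHeadCertΔ) (H2 : OddHeadCert2)
    (hmΔ : T.oddMatchOKΔ HΔ = true) (hVΔ : HΔ.R.ValidΔ T.c T.L T.ψ T.Lψ T.σlo T.σhi T.εlo T.εhi)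
    (hm2 : T.oddMatchOK2 H2 = true) (hV2 : H2.R.ValidΔ T.c T.L T.ψ T.Lψ T.σlo T.σhi T.εlo T.εhi)
    (hE2 : HeadParts2.Scal2OK H2.R.S H2.R.σ0 H2.R.ε0 H2.R.Wσ H2.R.Wε T.κ₀ H2.sc) (hW2 : H2.widthOK = true)
    (hpartsΔ : ∀ i k : ℕ, i < T.oddCells.length → sel i = false → k < HΔ.numParts i → HΔ.partOK i k = true)
    (hfinalΔ : ∀ i : ℕ, i < T.oddCells.length → sel i = false → T.oddFinalOKM HΔ i = true)
    (hparts2 : ∀ i k : ℕ, i < T.oddCells.length → sel i = true → k < H2.numParts i → H2.partOK i k = true)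
    (hfinal2 : ∀ i : ℕ, i < T.oddCells.length → sel i = true → H2.finalOK i = true)
    (hR : TaylorEvenRegion T.α T.box ((T.E₀ : ℚ) : ℝ)) (hC : T.OddCone) : BoxExcluded T.box := by
  have h' := h; simp only [checkS, Bool.and_eq_true] at h'
  obtain ⟨⟨⟨⟨⟨_, hI⟩, hEcells⟩, _⟩, hOcells⟩, _⟩ := h'
  exact T.boxExcluded_of_taylorTable_heads h (T.evenHeads_of_certΔ HE hEcells hmE hVE hpE hfE)
    (T.oddHeads_of_certMixed sel HΔ H2 (T.scalars_mem_of_checkIdentity hI HΔ.R.S) hOcells hmΔ hVΔ hm2 hV2 hE2 hW2 hpartsΔ hfinalΔ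
      hparts2 hfinal2) hR hC

end TaylorTable

end Summit.CriticalPhenomena.Ising3D


/-!
# XXXIg-C: the MIXED odd-head capstone under the CENTRED-FORM identity check (`boxExcluded_of_taylorTable_certMixedC`)
(cell `pub-ising3x`, seat boot-1 gen 18; BOX 3 of the γ-box programme — HOME/pub-ising3x-boot-1/b3spine-g17/IDENTITY-B3.md (vii)(b))

HONEST FRAMING: lottery ticket; floor = tightest certified 3D Ising CFT bounds; no exact-solution
claim without a proof. Island framing: certified exclusion region at stated derivative order and
assumptions; not a determination of the 3D Ising critical exponents beyond that.

`boxExcluded_of_taylorTable_certMixed` (module XXXIg) consumes the table's structural check `checkS`, whose identity conjunct is the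
natural-interval kd-certificate. A slaved-Ψ table (BOX 3 on) certifies obligation (I) by the one-leaf centred check instead
(`checkIdentityC` / `checkSC`, TaylorTableHeadsC); its power-enclosure memberships come from `scalars_mem_of_checkIdentityC`, which is
all `oddHeads_of_certMixed` needs. This file is that 15-line recombination: `checkSC` + even δ-head certificate + MIXED odd head
certificates (δ-merged finals off the selector, merged-2 cells on it) + even region + odd cone ⇒ the box is excluded.
[cite: KosPolandSimmonsduffin2014, §3.3 eq. (3.16)]
-/

namespace Summit.CriticalPhenomena.Ising3D

open Set
open Literature.Analysis.ValidatedNumerics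
open Literature.MathematicalPhysics.QuantumFieldTheory.ConformalBootstrap3D

namespace TaylorTable

variable (T : TaylorTable)

/-- **THE TABLE THEOREM with MIXED odd head certificates, centred-form identity route**: `checkSC` + the even δ-head certificate +
the δ-merged odd head certificate on the cells off the selector + the merged-2 odd head certificate on the cells on it + even region +
odd cone ⇒ the box is excluded (`boxExcluded_of_taylorTable_certMixed` with `checkS ↦ checkSC`,
`scalars_mem_of_checkIdentity ↦ scalars_mem_of_checkIdentityC`). [cite: KosPolandSimmonsduffin2014, §3.3 eq. (3.16)] -/
theorem boxExcluded_of_taylorTable_certMixedC (h : T.checkSC = true)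
    (HE : EvenHeadCertΔ) (hmE : T.evenMatchOKΔ HE = true) (hVE : HE.R.ValidΔ T.c T.L T.σlo T.σhi T.εlo T.εhi)
    (hpE : ∀ i k : ℕ, i < T.evenCells.length → k < HE.numParts i → HE.partOK i k = true)
    (hfE : ∀ i : ℕ, i < T.evenCells.length → HE.finalOK i = true)
    (sel : ℕ → Bool) (HΔ : OddHeadCertΔ) (H2 : OddHeadCert2)
    (hmΔ : T.oddMatchOKΔ HΔ = true) (hVΔ : HΔ.R.ValidΔ T.c T.L T.ψ T.Lψ T.σlo T.σhi T.εlo T.εhi)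
    (hm2 : T.oddMatchOK2 H2 = true) (hV2 : H2.R.ValidΔ T.c T.L T.ψ T.Lψ T.σlo T.σhi T.εlo T.εhi)
    (hE2 : HeadParts2.Scal2OK H2.R.S H2.R.σ0 H2.R.ε0 H2.R.Wσ H2.R.Wε T.κ₀ H2.sc) (hW2 : H2.widthOK = true)
    (hpartsΔ : ∀ i k : ℕ, i < T.oddCells.length → sel i = false → k < HΔ.numParts i → HΔ.partOK i k = true)
    (hfinalΔ : ∀ i : ℕ, i < T.oddCells.length → sel i = false → T.oddFinalOKM HΔ i = true)
    (hparts2 : ∀ i k : ℕ, i < T.oddCells.length → sel i = true → k < H2.numParts i → H2.partOK i k = true)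
    (hfinal2 : ∀ i : ℕ, i < T.oddCells.length → sel i = true → H2.finalOK i = true)
    (hR : TaylorEvenRegion T.α T.box ((T.E₀ : ℚ) : ℝ)) (hC : T.OddCone) : BoxExcluded T.box := by
  have h' := h; simp only [checkSC, Bool.and_eq_true] at h'
  obtain ⟨⟨⟨⟨⟨_, hI⟩, hEcells⟩, _⟩, hOcells⟩, _⟩ := h'
  exact T.boxExcluded_of_taylorTable_headsC h (T.evenHeads_of_certΔ HE hEcells hmE hVE hpE hfE)
    (T.oddHeads_of_certMixed sel HΔ H2 (T.scalars_mem_of_checkIdentityC hI HΔ.R.S) hOcells hmΔ hVΔ hm2 hV2 hE2 hW2 hpartsΔ hfinalΔ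
      hparts2 hfinal2) hR hC

end TaylorTable

end Summit.CriticalPhenomena.Ising3D
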